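import Mathlib
import HarnessLib
import Summits.Langlands.Langlands.Theses.SkinnerWilesDefectOne
import Literature.NumberTheory.GaloisRepresentations.NearlyOrdinaryRigidCondition

/-!
# Stable lines of a `GL₂`-representation in a diagonal frame (two-by-two algebra)

Route `SkinnerWilesDefectOne`, support item stmt-Langlands-14718
(`ProModularOfEisensteinSeed : EisensteinProModularSeed → ReducibleOrdinaryProModular`, Skinner–Wiles
steps (I)+(III) at defect one).  Matrix algebra behind the closedness of the reducible locus of the
nearly ordinary deformation ring (`Theorems/…ProModularOfEisensteinSeedReducibleLocus.lean`), in the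
spirit of Skinner–Wiles' rigid basis ([SW, §2.2, p. 16]: "Choose a basis for `ρ_𝒟` such that
`ρ_𝒟(z₁)` is diagonal … let `I` be the ideal generated by the `c_σ`'s.  Clearly `R_𝒟^red = R_𝒟/I`"):

* `exists_swap_conj_apply_10`, `exists_shear_conj_eq_diag` — the swap frame and the shear
  diagonalisation `T⁻¹ (α β; 0 δ) T = diag(α, δ)` for `T = (1 t; 0 1)`, `t (δ − α) = β`;
* `diag_ne_of_conj_upper` — of two conjugate upper-triangular `2 × 2` matrices over a field, if one
  has distinct diagonal entries so has the other (characteristic polynomials);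
* `isReducible_map_comp_iff_of_diag` — **common eigenlines in a diagonal frame**: for
  `ρ : Γ → GL₂(R)`, `D ∈ GL₂(R)`, `g₀` with `D⁻¹ ρ(g₀) D = diag(α, δ)` and a ring map `f : R → K` to a
  field with `f α ≠ f δ`, the representation `f ∘ ρ` is reducible (`Deformation.IsReducible`:
  conjugate to upper triangular) iff ALL `f c_γ = 0` or ALL `f b_γ = 0`, where
  `D⁻¹ ρ(γ) D = (a_γ b_γ; c_γ d_γ)` — a stable line over `K` is an eigenline of `diag(f α, f δ)`, i.e.
  a coordinate axis (via the tree's `lowerLeft_eq_zero_iff_det2`).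

References: C. M. Skinner, A. J. Wiles, *Residually reducible representations and modular forms*,
Publ. Math. IHÉS 89 (1999), §2.1–2.2. [SkinnerWiles1999]
-/

set_option linter.dupNamespace false -- project-wide option (lakefile weak.linter.dupNamespace); `Summit.Langlands.Langlands` is the mandated namespace

namespace Summit.Langlands.Langlands.Theorems

open scoped NumberField MatrixGroups
open IsDedekindDomain Field Polynomial Matrix IsLocalRing
open Literature.NumberTheory.GaloisRepresentations
open Literature.NumberTheory.GaloisRepresentations.Deformation

noncomputable section

/-! ### Two-by-two matrix algebra -/

section TwoByTwo

variable {A : Type*} [CommRing A]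

/-- **The swap frame**: there is `w ∈ GL₂(A)` (namely `(0 1; 1 0)`) conjugation by which exchanges
the off-diagonal entries, `(w⁻¹ X w)₁₀ = X₀₁`. [folklore] -/
theorem exists_swap_conj_apply_10 :
    ∃ w : GL (Fin 2) A, ∀ X : GL (Fin 2) A, (w⁻¹ * X * w).val 1 0 = X.val 0 1 := by
  let w : GL (Fin 2) A :=
    ⟨!![0, 1; 1, 0], !![0, 1; 1, 0],
      by ext i j; fin_cases i <;> fin_cases j <;> simp [Matrix.mul_apply, Fin.sum_univ_two],
      by ext i j; fin_cases i <;> fin_cases j <;> simp [Matrix.mul_apply, Fin.sum_univ_two]⟩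
  have h1 : (w⁻¹).val = !![0, 1; 1, 0] := rfl
  have h2 : w.val = !![0, 1; 1, 0] := rfl
  refine ⟨w, fun X => ?_⟩
  rw [Units.val_mul, Units.val_mul]
  simp only [Matrix.mul_apply, Fin.sum_univ_two]
  rw [h1, h2]
  simp

/-- **Shear diagonalisation of an upper-triangular matrix with unit diagonal difference**: if
`N = (α β; 0 δ)` and `t (δ − α) = β`, then for the elementary shear `T = (1 t; 0 1) ∈ GL₂(A)` one has
`T⁻¹ N T = diag(α, δ)` (entrywise). [folklore] -/
theorem exists_shear_conj_eq_diag (N : GL (Fin 2) A) (h10 : N.val 1 0 = 0) (t : A)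
    (ht : t * (N.val 1 1 - N.val 0 0) = N.val 0 1) :
    ∃ T : GL (Fin 2) A,
      (T⁻¹ * N * T).val 0 0 = N.val 0 0 ∧ (T⁻¹ * N * T).val 0 1 = 0 ∧
      (T⁻¹ * N * T).val 1 0 = 0 ∧ (T⁻¹ * N * T).val 1 1 = N.val 1 1 := by
  let T : GL (Fin 2) A :=
    ⟨!![1, t; 0, 1], !![1, -t; 0, 1],
      by ext i j; fin_cases i <;> fin_cases j <;> simp [Matrix.mul_apply, Fin.sum_univ_two],
      by ext i j; fin_cases i <;> fin_cases j <;> simp [Matrix.mul_apply, Fin.sum_univ_two]⟩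
  have h1 : (T⁻¹).val = !![1, -t; 0, 1] := rfl
  have h2 : T.val = !![1, t; 0, 1] := rfl
  refine ⟨T, ?_⟩
  rw [Units.val_mul, Units.val_mul]
  simp only [Matrix.mul_apply, Fin.sum_univ_two]
  rw [h1, h2]
  simp only [Matrix.of_apply, Matrix.cons_val', Matrix.cons_val_zero, Matrix.cons_val_one,
    Matrix.empty_val', Matrix.cons_val_fin_one, h10]
  refine ⟨?_, ?_, ?_, ?_⟩
  · ring
  · linear_combination (-1 : A) * ht
  · ring
  · ring

/-- The first column of an invertible `2 × 2` matrix over a nontrivial ring is not zero.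
[folklore] -/
theorem col_zero_ne_zero [Nontrivial A] (Q : GL (Fin 2) A) : ¬ (Q.val 0 0 = 0 ∧ Q.val 1 0 = 0) := by
  rintro ⟨h0, h1⟩
  have hdet : IsUnit Q.val.det := (Matrix.isUnit_iff_isUnit_det _).mp (Units.isUnit Q)
  rw [Matrix.det_fin_two, h0, h1, zero_mul, mul_zero, sub_zero] at hdet
  exact not_isUnit_zero hdet

/-- **Distinct roots are detected by the characteristic polynomial**: over a field, if
`(X − a)(X − b) = (X − c)(X − d)` and `c ≠ d` then `a ≠ b`. [folklore] -/
theorem ne_of_prod_X_sub_C_eq {K : Type*} [Field K] {a b c d : K}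
    (h : (X - C a) * (X - C b) = (X - C c) * (X - C d)) (hcd : c ≠ d) : a ≠ b := by
  intro hab
  subst hab
  have hc : (c - a) ^ 2 = 0 := by
    have := congrArg (Polynomial.eval c) h
    simp only [eval_mul, eval_sub, eval_X, eval_C, sub_self, zero_mul] at this
    rw [pow_two, this]
  have hd : (d - a) ^ 2 = 0 := by
    have := congrArg (Polynomial.eval d) h
    simp only [eval_mul, eval_sub, eval_X, eval_C, sub_self, mul_zero] at this
    rw [pow_two, this]
  have hd' : d = a := by
    have := (pow_eq_zero_iff (n := 2) two_ne_zero).mp hd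
    exact sub_eq_zero.mp this
  have hc'' : c = a := by
    have := (pow_eq_zero_iff (n := 2) two_ne_zero).mp hc
    exact sub_eq_zero.mp this
  exact hcd (hc''.trans hd'.symm)

/-- The characteristic polynomial of an upper-triangular `2 × 2` matrix. [folklore] -/
theorem charpoly_of_apply_10_eq_zero (M : Matrix (Fin 2) (Fin 2) A) (h : M 1 0 = 0) :
    M.charpoly = (X - C (M 0 0)) * (X - C (M 1 1)) := by
  have hM : M.BlockTriangular id := by
    intro i j hij
    fin_cases i <;> fin_cases j <;> simp at hij ⊢
    exact h
  rw [Matrix.charpoly_of_upperTriangular M hM, Fin.prod_univ_two]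

/-- Two conjugate upper-triangular `2 × 2` matrices over a field: if one has distinct diagonal
entries, so has the other. [folklore] -/
theorem diag_ne_of_conj_upper {K : Type*} [Field K] (U : GL (Fin 2) K)
    (M N : Matrix (Fin 2) (Fin 2) K) (hconj : N = U.val⁻¹ * M * U.val)
    (hM : M 1 0 = 0) (hN : N 1 0 = 0) (hne : M 0 0 ≠ M 1 1) : N 0 0 ≠ N 1 1 := by
  have hchar : N.charpoly = M.charpoly := by
    rw [hconj]
    exact Matrix.charpoly_units_conj' U M
  rw [charpoly_of_apply_10_eq_zero N hN, charpoly_of_apply_10_eq_zero M hM] at hchar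
  exact ne_of_prod_X_sub_C_eq hchar hne

end TwoByTwo

/-! ### Stable lines in a diagonal frame -/

section StableAxis

variable {Γ : Type*} [Group Γ] {R : Type*} [CommRing R] {K : Type*} [Field K]

/-- **Common eigenlines in a diagonal frame.**  Let `ρ : Γ → GL₂(R)`, `D ∈ GL₂(R)` and `g₀ ∈ Γ`
with `D⁻¹ ρ(g₀) D = diag(α, δ)`, and let `f : R → K` be a ring map to a field with `f α ≠ f δ`.
Write `D⁻¹ ρ(γ) D = (a_γ b_γ; c_γ d_γ)`.  Then `f ∘ ρ` is reducible (conjugate over `K` to an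
upper-triangular representation) iff ALL `f c_γ = 0` or ALL `f b_γ = 0`: a `Γ`-stable line over `K`
is stable under `diag(f α, f δ)`, hence is a coordinate axis of the frame `D`; the axis `K e₀` is
stable iff every `c_γ` dies in `K`, the axis `K e₁` iff every `b_γ` does.
[cite: SkinnerWiles1999, §2.2] -/
theorem isReducible_map_comp_iff_of_diag (ρ : Γ →* GL (Fin 2) R) (D : GL (Fin 2) R) (g₀ : Γ)
    (h01 : (D⁻¹ * ρ g₀ * D).val 0 1 = 0) (h10 : (D⁻¹ * ρ g₀ * D).val 1 0 = 0) (f : R →+* K)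
    (hne : f ((D⁻¹ * ρ g₀ * D).val 0 0) ≠ f ((D⁻¹ * ρ g₀ * D).val 1 1)) :
    IsReducible ((Matrix.GeneralLinearGroup.map f).comp ρ) ↔
      (∀ γ, f ((D⁻¹ * ρ γ * D).val 1 0) = 0) ∨ (∀ γ, f ((D⁻¹ * ρ γ * D).val 0 1) = 0) := by
  -- `ρ' = D⁻¹ ρ D` and its entries over `K`
  have hentry : ∀ (γ : Γ) (i j : Fin 2),
      (Matrix.GeneralLinearGroup.map f (D⁻¹ * ρ γ * D)).val i j = f ((D⁻¹ * ρ γ * D).val i j) :=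
    fun γ i j => rfl
  have hconjK : ∀ (Q : GL (Fin 2) K) (γ : Γ),
      Q⁻¹ * (Matrix.GeneralLinearGroup.map f).comp ρ γ * Q =
        ((Matrix.GeneralLinearGroup.map f D)⁻¹ * Q)⁻¹ * Matrix.GeneralLinearGroup.map f (D⁻¹ * ρ γ * D) *
          ((Matrix.GeneralLinearGroup.map f D)⁻¹ * Q) := fun Q γ => by
    simp only [MonoidHom.comp_apply, map_mul, map_inv]
    group
  constructor
  · -- (→): a stable line is a coordinate axis of the diagonal frame
    rintro ⟨Q, hQ⟩
    set Q' : GL (Fin 2) K := (Matrix.GeneralLinearGroup.map f D)⁻¹ * Q with hQ'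
    have hQ'up : ∀ γ, ((Q'⁻¹).val * (Matrix.GeneralLinearGroup.map f (D⁻¹ * ρ γ * D)).val * Q'.val) 1 0 = 0 := by
      intro γ
      have := hQ γ
      rw [hconjK Q γ] at this
      exact this
    -- the first column `x` of `Q'` spans the stable line
    set x : Fin 2 → K := fun i => Q'.val i 0 with hx
    have hdet : ∀ γ,
        det2 x (fun i => ((Matrix.GeneralLinearGroup.map f (D⁻¹ * ρ γ * D)).val * Q'.val) i 0) = 0 :=
      fun γ => (lowerLeft_eq_zero_iff_det2 Q' _).mp (hQ'up γ)
    have hcol : ∀ (γ : Γ) (i : Fin 2),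
        ((Matrix.GeneralLinearGroup.map f (D⁻¹ * ρ γ * D)).val * Q'.val) i 0 =
          f ((D⁻¹ * ρ γ * D).val i 0) * x 0 + f ((D⁻¹ * ρ γ * D).val i 1) * x 1 := fun γ i => by
      rw [Matrix.mul_apply, Fin.sum_univ_two, hentry, hentry]
    -- at `g₀`: `(f δ − f α) x₀ x₁ = 0`, so `x₀ x₁ = 0`
    have hx01 : x 0 * x 1 = 0 := by
      have h := hdet g₀
      simp only [det2, hcol, h01, h10, map_zero, zero_mul, add_zero, zero_add] at h
      have h' : (f ((D⁻¹ * ρ g₀ * D).val 1 1) - f ((D⁻¹ * ρ g₀ * D).val 0 0)) * (x 0 * x 1) = 0 := by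
        linear_combination h
      rcases mul_eq_zero.mp h' with h'' | h''
      · exact absurd (by linear_combination -h'') hne
      · exact h''
    have hxne : ¬ (x 0 = 0 ∧ x 1 = 0) := col_zero_ne_zero Q'
    rcases mul_eq_zero.mp hx01 with hx0 | hx1
    · -- `x₀ = 0`: the axis `K e₁` is stable, every `b_γ` vanishes
      have hx1 : x 1 ≠ 0 := fun h => hxne ⟨hx0, h⟩
      refine Or.inr fun γ => ?_
      have h := hdet γ
      simp only [det2, hcol, hx0, mul_zero, zero_add, zero_mul, zero_sub, neg_eq_zero] at h
      -- `h : x 1 * (f b * x 1) = 0`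
      rcases mul_eq_zero.mp h with h' | h'
      · exact absurd h' hx1
      · rcases mul_eq_zero.mp h' with h'' | h''
        · exact h''
        · exact absurd h'' hx1
    · -- `x₁ = 0`: the axis `K e₀` is stable, every `c_γ` vanishes
      have hx0 : x 0 ≠ 0 := fun h => hxne ⟨h, hx1⟩
      refine Or.inl fun γ => ?_
      have h := hdet γ
      simp only [det2, hcol, hx1, mul_zero, add_zero, zero_mul, sub_zero] at h
      -- `h : x 0 * (f c * x 0) = 0`
      rcases mul_eq_zero.mp h with h' | h'
      · exact absurd h' hx0
      · rcases mul_eq_zero.mp h' with h'' | h''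
        · exact h''
        · exact absurd h'' hx0
  · -- (←): conjugate by `D` (resp. `D w`)
    rintro (hc | hb)
    · refine ⟨Matrix.GeneralLinearGroup.map f D, fun γ => ?_⟩
      have e : (Matrix.GeneralLinearGroup.map f D)⁻¹ * (Matrix.GeneralLinearGroup.map f).comp ρ γ *
          Matrix.GeneralLinearGroup.map f D = Matrix.GeneralLinearGroup.map f (D⁻¹ * ρ γ * D) := by
        rw [map_mul, map_mul, map_inv, MonoidHom.comp_apply]
      rw [e, hentry]
      exact hc γ
    · obtain ⟨w, hw⟩ := exists_swap_conj_apply_10 (A := K)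
      refine ⟨Matrix.GeneralLinearGroup.map f D * w, fun γ => ?_⟩
      have e : (Matrix.GeneralLinearGroup.map f D * w)⁻¹ *
          (Matrix.GeneralLinearGroup.map f).comp ρ γ * (Matrix.GeneralLinearGroup.map f D * w) =
            w⁻¹ * Matrix.GeneralLinearGroup.map f (D⁻¹ * ρ γ * D) * w := by
        simp only [MonoidHom.comp_apply, map_mul, map_inv]
        group
      rw [e, hw, hentry]
      exact hb γ

end StableAxis

end

end Summit.Langlands.Langlands.Theorems
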